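import Summits.PneNP.PneNP.Theses.SymmetryBudget
import Literature.Computability.Complexity.SymmetricCircuit

/-!
# `WindowHam` (crux stmt-PneNP-2143): `Circuit.size` counts GATES — a size-1 symmetric circuit of
# fan-in `m²·2^m` (negative-side modelling lemma F16)

Support file of the crux disprover (cdisprove seat, cycle 2); nothing positive about any route item.
The crux bounds `C.size ≤ p m`; fan-in and wire multiplicities are unbounded and invisible to that
bound. Witness `heavyAnd m`: ONE `∧`-gate reading every matrix entry `2^m` times — over `tcBasis`, of
size `1`, symmetric under EVERY permutation set, fan-in `m²·2^m`. Consequences for provers: "WLOG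
rigid" (rigidification realises multiplicities by `∧₁`-chains), "WLOG simply wired / polynomial
fan-in / polynomial weights" (weight reduction is an ordered adder, not equivariant) are NOT free
normalisations in this model; each needs a symmetric lemma first.
-/

namespace Summit.PneNP.PneNP.Theorems.WindowHam.Negative

open Literature.Computability.Complexity

/-- The read map of the heavy gate: argument position `a` reads entry number `a / 2^m` (so every entry is read `2^m` times). -/
def heavyRead (m : ℕ) (a : Fin (m * m * 2 ^ m)) : Fin m × Fin m :=
  finProdFinEquiv.symm (finProdFinEquiv.symm a).1

/-- **F16 witness.** The one-gate circuit `∧` of ALL matrix entries, each wired `2^m` times: size `1`, fan-in `m²·2^m`. -/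
def heavyAnd (m : ℕ) : Circuit (Fin m × Fin m) where
  gates := [⟨m * m * 2 ^ m, (GateFn.and (m * m * 2 ^ m)).2, fun a => Sum.inl (heavyRead m a)⟩]
  output := .inr 0
  wf j hj a k hk := by
    simp only [List.length_singleton, Nat.lt_one_iff] at hj
    subst hj
    simp at hk
  wf_output k hk := by cases hk; simp

/-- Size one. -/
theorem heavyAnd_size (m : ℕ) : (heavyAnd m).size = 1 := rfl

/-- Fan-in `m²·2^m`. -/
theorem heavyAnd_maxFanIn (m : ℕ) : (heavyAnd m).maxFanIn = m * m * 2 ^ m := by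
  simp [heavyAnd, Circuit.maxFanIn]

/-- Over the threshold basis (indeed `acBasis`). -/
theorem heavyAnd_isOver (m : ℕ) : (heavyAnd m).IsOver tcBasis := by
  intro g hg
  simp only [heavyAnd, List.mem_singleton] at hg
  subst hg
  exact acBasis_subset_tcBasis (Or.inr (Set.mem_iUnion.2 ⟨_, Or.inl rfl⟩))

/-- The permutation of argument positions induced by a vertex permutation. -/
def heavyPerm (m : ℕ) (ρ : Equiv.Perm (Fin m)) : Equiv.Perm (Fin (m * m * 2 ^ m)) :=
  finProdFinEquiv.symm.trans ((Equiv.prodCongr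
    (finProdFinEquiv.symm.trans ((Equiv.prodCongr ρ ρ).trans finProdFinEquiv)) (Equiv.refl _)).trans
      finProdFinEquiv)

/-- The read map intertwines the induced permutation with the diagonal action. -/
theorem heavyRead_heavyPerm (m : ℕ) (ρ : Equiv.Perm (Fin m)) (a : Fin (m * m * 2 ^ m)) :
    heavyRead m (heavyPerm m ρ a) = ((ρ (heavyRead m a).1, ρ (heavyRead m a).2) : Fin m × Fin m) := by
  simp [heavyRead, heavyPerm]

/-- **Symmetric under EVERY set of vertex permutations** (the identity on the single gate; `ρ` only permutes the argument positions). -/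
theorem heavyAnd_isSymmetricUnder (m : ℕ) (Γ : Set (Equiv.Perm (Fin m))) : (heavyAnd m).IsSymmetricUnder Γ := by
  intro ρ _
  refine ⟨1, ?_, ?_⟩
  · show Sum.inr (Circuit.relabelGate (1 : Equiv.Perm (Fin 1)) 0) = Sum.inr 0
    rw [Circuit.relabelGate_of_lt _ Nat.one_pos]
    rfl
  · intro j
    obtain ⟨j, hj⟩ := j
    have hj0 : j = 0 := by
      simp only [heavyAnd, List.length_singleton] at hj
      omega
    subst hj0
    refine ⟨rfl, ?_⟩
    show (List.ofFn fun a : Fin (m * m * 2 ^ m) => (Sum.inl (heavyRead m a) : (Fin m × Fin m) ⊕ ℕ)).Perm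
      ((List.ofFn fun a : Fin (m * m * 2 ^ m) => (Sum.inl (heavyRead m a) : (Fin m × Fin m) ⊕ ℕ)).map
        (Circuit.relabelWire (fun q : Fin m × Fin m => (ρ q.1, ρ q.2)) (1 : Equiv.Perm (Fin 1))))
    rw [List.map_ofFn]
    refine List.Perm.symm ?_
    convert Equiv.Perm.ofFn_comp_perm (heavyPerm m ρ)
      (fun a : Fin (m * m * 2 ^ m) => (Sum.inl (heavyRead m a) : (Fin m × Fin m) ⊕ ℕ)) using 2
    funext a
    simp only [Function.comp_apply, Circuit.relabelWire_inl, heavyRead_heavyPerm]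

/-- **F16: `size ≤ p m` bounds neither fan-in nor multiplicities.** At every `m` and under every permutation set there is a
`tcBasis` circuit of size `1`, symmetric, with fan-in `m²·2^m` (superpolynomial). -/
theorem exists_size_one_superpoly_fanIn (m : ℕ) (Γ : Set (Equiv.Perm (Fin m))) :
    ∃ C : Circuit (Fin m × Fin m), C.IsOver tcBasis ∧ C.IsSymmetricUnder Γ ∧ C.size = 1 ∧
      C.maxFanIn = m * m * 2 ^ m :=
  ⟨heavyAnd m, heavyAnd_isOver m, heavyAnd_isSymmetricUnder m Γ, heavyAnd_size m, heavyAnd_maxFanIn m⟩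

end Summit.PneNP.PneNP.Theorems.WindowHam.Negative
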